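import Summits.ResolutionOfSingularities.ResolutionOfSingularities.Theorems.HilbertSamuelEliminationSigmaMaxModificationsCorridor3WLadderStrataCentreDispatch
import Summits.ResolutionOfSingularities.ResolutionOfSingularities.Theorems.HilbertSamuelEliminationSigmaMaxModificationsCorridor3WLadderStrataCentrePointCase
import Literature.AlgebraicGeometry.CossartJannsenSaito2020.BlowupTowerLocalizePerm
import Literature.AlgebraicGeometry.Resolution.CofinalityFromPrincipalization
import Summits.ResolutionOfSingularities.ResolutionOfSingularities.Theorems.HilbertSamuelEliminationSigmaMaxModificationsCorridor3WLadderRationalNearStep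
import HarnessLib

/-!
# [OURS · L1 W4.2] The STRATA-half of the MOVING W-ladder, eleventh layer: row (K-ctr-pt) CLOSED modulo print — the point-germ case
# of «clean members over the centre» by LOCALISING the step at the chain point and res-D-pv-038's point-centre theorem (p520827)

Crux chain w42 (`SigmaMaxModifications`, stmt-ResolutionOfSingularities-18506; conjunct stmt-ResolutionOfSingularities-19249), row «stub-4 →
`Moving.Wlow3CharStrataM p`», sub-row (K-ctr-pt) `StrataPointCentreMembersClean` (p522551), seat res-L1-w42-stub-4 (gen 4). OURS (cell
res-hironaka, slot W4.2); NOT statements of H. Hironaka's manuscript [Hironaka2017] nor of [CossartJannsenSaito2020]; AI-drafted, weaker than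
expert review. Pure proofs (no definitions), CONDITIONAL on two printed facts BY NAME: CJS Thm. 3.14 point-centre locus form
`(h314pt : Thm314_point_locus)` (p503241) and CJS Def. 6.38 (ii) «`ℙ(Dir_x) ≅ ℙ¹_{k(x)}`» `(hPa : ProjDir_projLine)` (p516003). Helper
file `--supports stmt-ResolutionOfSingularities-19249`.

## The argument

At a late step with point germ of the centre at `x_n` (`x_n` has no other generisation in `V(C)`), base-change THE blow-up
`π : Bl_C(X_n) → X_n` along `ι₀ : Spec 𝒪_{X_n,x_n} → X_n` (flat preimmersion): `π_P : P = Bl ×_{X_n} Spec 𝒪 → Spec 𝒪` is a blow-up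
along `C·𝒪 = I(ι₀⁻¹V(C)) = I({closed point})` (tree `IsBlowup.pullback_snd_of_flat`, `comap_vanishingIdeal_eq_of_flat_of_isPreimmersion`;
`V(C)` is reduced since regular), i.e. THE POINT BLOW-UP of the excellent local scheme, whose closed point is permissible, of dimension
`≤ 3`, with the same `H`, `e`, (F1) as `x_n` (iso stalks). res-D-pv-038's `strataCentreMembersClean_pointCase` applies on `P`. The
members of `componentsThrough` over `x_n` lie in the fibre `π⁻¹(x_n) ⊆ range(j)`, `j = pr₁ : P → Bl` a flat preimmersion (a
topological embedding with isomorphic stalks), so they correspond to members through the marked point of `P`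
(`j⁻¹`/`j(·)`), and «regular curve at the point» transports along `j` (stalk isomorphism, `I(j⁻¹Z′) = I(Z′)·𝒪_P`, and the
dictionary «curve ⟺ dim ≤ 1» of p520757).

## What is proved

`strataPointCentreMembersClean_of_pointCase : ProjDir_projLine → Thm314_point_locus → StrataPointCentreMembersClean p 3 (QNe (QCharRegime p))
(ē ≤ 2)`, hence (with p522551) `strataCentreMembersClean_of_pointCase_curve : h314 → h314f → hPa → h314pt → (K-ctr-cv) → (K-ctr)` and
`wlow3CharStrataM_of_printed_curve_centreIO : h314 → h314f → hPa → h314pt → (K-ctr-cv) → (c-geo) → Wlow3CharStrataM p` — **the STRATA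
row from FOUR printed facts and the TWO local geometric kernels (K-ctr-cv), (c-geo)**.

References: CJS LNM 2270 Thm. 3.14, Def. 6.38 (ii), Prop. 6.31, p. 107 [CossartJannsenSaito2020]; GW Prop. 13.91 (2) [GortzWedhorn2020];
tree res-D-pv-038 p520827 (`…StrataCentrePointCase`), res-type-053 (`…BlowupTowerLocalize*`), `…BlowupsFlatBaseChange`, this seat's
p520757 / p522551.
-/

noncomputable section

-- plan-1/idea-2 module setting kept (namespace `…Corridor3.Moving` re-enters `…Corridor3`)
set_option linter.dupNamespace false

open CategoryTheory CategoryTheory.Limits AlgebraicGeometry TopologicalSpace Topology IsLocalRing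
open Summit.ResolutionOfSingularities.ResolutionOfSingularities.Theorems.CampaignW42
open Literature.AlgebraicGeometry.Resolution Literature.RingTheory.HilbertSamuel
open Literature.AlgebraicGeometry.CossartJannsenSaito2020
open Summit.ResolutionOfSingularities.ResolutionOfSingularities.Theorems.SigmaMaxModificationsCorridor3

universe u

namespace Summit.ResolutionOfSingularities.ResolutionOfSingularities.Theorems.SigmaMaxModificationsCorridor3.Moving

variable {R : ∀ S : Scheme.{u}, CentreSeq S → Prop} {N : ℕ} {ν : ℕ → ℕ}

/-! ## §1. Plumbing: preimages under embeddings, residue characteristics, transport of «regular curve at the point» -/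

/-- The preimage of an irreducible set contained in the range of a topological embedding is irreducible. [folklore] -/
theorem isIrreducible_preimage_of_isEmbedding {A B : Type*} [TopologicalSpace A] [TopologicalSpace B] {f : A → B}
    (hf : IsEmbedding f) {Z : Set B} (hZ : IsIrreducible Z) (hZr : Z ⊆ Set.range f) : IsIrreducible (f ⁻¹' Z) := by
  obtain ⟨z, hz⟩ := hZ.nonempty
  obtain ⟨a, rfl⟩ := hZr hz
  refine ⟨⟨a, hz⟩, fun U V hU hV ⟨u, huZ, huU⟩ ⟨v, hvZ, hvV⟩ => ?_⟩
  obtain ⟨U', hU', rfl⟩ := hf.isInducing.isOpen_iff.mp hU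
  obtain ⟨V', hV', rfl⟩ := hf.isInducing.isOpen_iff.mp hV
  obtain ⟨b, hbZ, hbU, hbV⟩ := hZ.isPreirreducible U' V' hU' hV' ⟨f u, huZ, huU⟩ ⟨f v, hvZ, hvV⟩
  obtain ⟨c, rfl⟩ := hZr hbZ
  exact ⟨c, hbZ, hbU, hbV⟩

/-- **«Regular curve at the point» transports along a morphism with isomorphic stalks that is a topological embedding**
(a flat preimmersion `j : P → X′`, e.g. a base change of `Spec 𝒪_{X,x} → X`): for a closed irreducible `Z′` through the
closed point `j(q)`, if `j⁻¹Z′` is a regular curve at `q` then `Z′` is a regular curve at `j(q)`.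
[cite: CossartJannsenSaito2020, Prop. 6.31, p. 107] -/
theorem isRegularCurveAt_of_preimage {s s' : MarkedStage.{u}} (j : s'.W ⟶ s.W) [Flat j] [IsPreimmersion j]
    (hpt : j.base s'.pt = s.pt) (hptcl : IsClosed ({s.pt} : Set s.W)) {Z' : Set s.W} (hZ'irr : IsIrreducible Z')
    (hZ'cl : IsClosed Z') (h : IsRegularCurveAt s' (j.base ⁻¹' Z')) :
    IsRegularCurveAt s Z' := by
  haveI := s.ln
  haveI := s'.ln
  obtain ⟨hq, hreg, hcurve⟩ := h
  have hx : s.pt ∈ Z' := by have := hq; rwa [Set.mem_preimage, hpt] at this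
  haveI := isIso_stalkMap_of_flat_of_isPreimmersion j s'.pt
  -- `I(j⁻¹Z′) = I(Z′)·𝒪_P`, and its stalk at `q` is the image of `I(Z′)_{j q}` under the stalk isomorphism
  have hcomap : (Scheme.IdealSheafData.vanishingIdeal ⟨Z', hZ'cl⟩).comap j =
      Scheme.IdealSheafData.vanishingIdeal ⟨j.base ⁻¹' Z', hZ'cl.preimage j.continuous⟩ :=
    comap_vanishingIdeal_eq_of_flat_of_isPreimmersion j ⟨Z', hZ'cl⟩
  let e : s.W.presheaf.stalk (j.base s'.pt) ≃+* s'.W.presheaf.stalk s'.pt := (asIso (j.stalkMap s'.pt)).commRingCatIsoToRingEquiv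
  have hmap : stalkIdeal (Scheme.IdealSheafData.vanishingIdeal ⟨j.base ⁻¹' Z', hZ'cl.preimage j.continuous⟩) s'.pt =
      (stalkIdeal (Scheme.IdealSheafData.vanishingIdeal ⟨Z', hZ'cl⟩) (j.base s'.pt)).map e.toRingHom := by
    rw [← hcomap, stalkIdeal_comap_eq_map_stalkMap]; rfl
  let eq : (s.W.presheaf.stalk (j.base s'.pt) ⧸ stalkIdeal (Scheme.IdealSheafData.vanishingIdeal ⟨Z', hZ'cl⟩) (j.base s'.pt)) ≃+*
      (s'.W.presheaf.stalk s'.pt ⧸ stalkIdeal (Scheme.IdealSheafData.vanishingIdeal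
        ⟨j.base ⁻¹' Z', hZ'cl.preimage j.continuous⟩) s'.pt) :=
    Ideal.quotientEquiv _ _ e hmap
  have hreg' : IsRegularLocalRing (s.W.presheaf.stalk (j.base s'.pt) ⧸
      stalkIdeal (Scheme.IdealSheafData.vanishingIdeal ⟨Z', hZ'cl⟩) (j.base s'.pt)) := by
    haveI := hreg (hZ'cl.preimage j.continuous); exact IsRegularLocalRing.of_ringEquiv eq.symm
  have hdim' : ringKrullDim (s.W.presheaf.stalk (j.base s'.pt) ⧸
      stalkIdeal (Scheme.IdealSheafData.vanishingIdeal ⟨Z', hZ'cl⟩) (j.base s'.pt)) ≤ 1 := by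
    rw [ringKrullDim_eq_of_ringEquiv eq]
    exact ringKrullDim_quotient_le_one_of_curve (hZ'cl.preimage j.continuous) hcurve
  rw [hpt] at hreg' hdim'
  exact ⟨hx, fun hcl => by convert hreg', curve_of_ringKrullDim_quotient_le_one hZ'irr hZ'cl hptcl hdim'⟩


/-! ## §2. Row (K-ctr-pt) from res-D-pv-038's point-centre theorem by localisation -/

/-- **(K-ctr-pt) ALONG ONE STEP PROJECTION** (modulo `ProjDir_projLine`, `Thm314_point_locus`): for the blow-down `f : X_{n+1} ⟶ X_n`
of a canonical near step with regular permissible centre `C ∋ x_n` having point germ at `x_n`, on an excellent Noetherian stage of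
dimension `≤ N` with (F1) at `x_n ∈ X_n(ν)` and `e_{x_n} = 2`, the components of `X_{n+1}(ν)` through `x_{n+1}` over `x_n` number at
most one and are regular curves at `x_{n+1}` — by localising at `x_n` (module docstring).
[cite: CossartJannsenSaito2020, Thm. 3.14, Def. 6.38 (ii), Prop. 6.31, p. 107] -/
theorem StepProjection.pointGerm_members_clean (hPa : ProjDir_projLine.{u}) (h314pt : Thm314_point_locus.{u})
    (hRf : OracleFunctional R) {s s' : MarkedStage.{u}} {f : s'.W ⟶ s.W} (hf : StepProjection R N ν s s' f)
    {C : s.W.IdealSheafData} {P' : Option (Pending (blowup C))} (hcs : IsCanonicalStep R N ν s.L s.P C P')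
    [IsNoetherian s.W] (hs'N : IsNoetherian s'.W) (hexcW : Scheme.IsExcellent s.W)
    (hdimW : topologicalKrullDim s.W ≤ (N : WithBot ℕ∞)) (hchar : CharHypothesis s.W s.pt)
    (hptn : s.pt ∈ Scheme.hsStratum s.W N ν) (hY'cl : IsClosed (Scheme.hsStratum s'.W N ν))
    (hCreg : Scheme.IsRegular C.subscheme) (hCperm : IdealSheafData.IsPermissible C) (hxC : s.pt ∈ (C.support : Set s.W))
    (hgerm : ∀ a ∈ (C.support : Set s.W), a ⤳ s.pt → a = s.pt) (he : dirDim s = 2) :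
    (∀ Z' ∈ componentsThrough N ν s', ∀ Z'' ∈ componentsThrough N ν s',
        f.base '' Z' ⊆ {s.pt} → f.base '' Z'' ⊆ {s.pt} → Z' = Z'') ∧
      ∀ Z' ∈ componentsThrough N ν s', f.base '' Z' ⊆ {s.pt} → IsRegularCurveAt s' Z' := by
  haveI := s.ln
  -- pass to the chosen blow-up
  obtain ⟨C₂, P₂, hln, x', hcs₂, hπ, hcl, hx', e, rfl⟩ := hf
  obtain rfl : C₂ = C := hcs₂.centre_unique hRf hcs
  subst e
  simp only [eqToHom_refl, Category.id_comp]
  haveI : IsLocallyNoetherian (blowup C₂) := hln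
  haveI : IsNoetherian (blowup C₂) := hs'N
  have hY'cl' : IsClosed (Scheme.hsStratum (blowup C₂) N ν) := hY'cl
  -- the localisation `ι₀ : Spec 𝒪_{W,x_n} → W` and the base-changed step
  haveI : IsProper (blowup.π C₂) := (blowup.isBlowup C₂).isProper
  set ι₀ := s.W.fromSpecStalk s.pt with hι₀
  haveI : Flat ι₀ := flat_fromSpecStalk s.W s.pt
  set P := pullback (blowup.π C₂) ι₀ with hP
  set j : P ⟶ blowup C₂ := pullback.fst (blowup.π C₂) ι₀ with hj
  set πP : P ⟶ Spec (s.W.presheaf.stalk s.pt) := pullback.snd (blowup.π C₂) ι₀ with hπP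
  have hsq : j ≫ blowup.π C₂ = πP ≫ ι₀ := pullback.condition
  haveI : IsLocallyNoetherian P := LocallyOfFiniteType.isLocallyNoetherian πP
  -- the centre pulls back to the closed point
  set o := closedPoint (s.W.presheaf.stalk s.pt) with ho
  have hoc : IsClosed ({o} : Set ↥(Spec (s.W.presheaf.stalk s.pt))) := isClosed_singleton_closedPoint _
  let Co : Closeds ↥(Spec (s.W.presheaf.stalk s.pt)) := ⟨{o}, hoc⟩
  have hι₀o : ι₀.base o = s.pt := Scheme.fromSpecStalk_closedPoint
  haveI := hCreg.isReduced
  have hCv : C₂ = Scheme.IdealSheafData.vanishingIdeal C₂.support := by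
    have h1 : C₂ = (⊥ : C₂.subscheme.IdealSheafData).map C₂.subschemeι := by
      rw [Scheme.IdealSheafData.map_bot, Scheme.IdealSheafData.ker_subschemeι]
    have h2 : (⊥ : C₂.subscheme.IdealSheafData) = Scheme.IdealSheafData.vanishingIdeal ⊤ := by
      rw [Scheme.IdealSheafData.vanishingIdeal_top, Scheme.nilradical_eq_bot]
    rw [h1, h2, Scheme.IdealSheafData.map_vanishingIdeal]
    congr 1
  have hpre : C₂.support.preimage ι₀.continuous = Co := by
    apply Closeds.ext
    ext q
    change ι₀.base q ∈ (C₂.support : Set s.W) ↔ q ∈ ({o} : Set _)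
    constructor
    · intro hq'
      have hqx : ι₀.base q = s.pt := hgerm _ hq' (fromSpecStalk_specializes q)
      exact ι₀.isEmbedding.injective (hqx.trans hι₀o.symm)
    · rintro rfl
      rw [hι₀o]; exact hxC
  have hcomapC : C₂.comap ι₀ = Scheme.IdealSheafData.vanishingIdeal Co := by
    conv_lhs => rw [hCv]
    rw [comap_vanishingIdeal_eq_of_flat_of_isPreimmersion ι₀ C₂.support, hpre]
  have hbl : IsBlowup πP (Scheme.IdealSheafData.vanishingIdeal Co) :=
    hcomapC ▸ (blowup.isBlowup C₂).pullback_snd_of_flat ι₀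
  -- the marked point of `P` over `x'` and `o`
  have hx'o : (blowup.π C₂).base x' = ι₀.base o := by rw [hπ, hι₀o]
  obtain ⟨q, hjq, hπPq⟩ := Scheme.Pullback.exists_preimage_pullback (f := blowup.π C₂) (g := ι₀) x' o hx'o
  let sP : MarkedStage.{u} := ⟨P, inferInstance, Labelling.init P, none, q⟩
  -- hypotheses of the point-centre theorem on `Spec 𝒪_{W,x_n}`
  haveI := isIso_stalkMap_of_flat_of_isPreimmersion ι₀ o
  have hexc : Scheme.IsExcellent (Spec (s.W.presheaf.stalk s.pt)) :=
    Scheme.isExcellent_Spec_of_isExcellentRing _ (isExcellentRing_stalk_of_isExcellent hexcW s.pt)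
  have hperm : IdealSheafData.IsPermissible (Scheme.IdealSheafData.vanishingIdeal Co) :=
    hcomapC ▸ isPermissible_comap_of_flat_of_isPreimmersion ι₀ C₂ hCperm
  have hdim : topologicalKrullDim ↥(Spec (s.W.presheaf.stalk s.pt)) ≤ (N : WithBot ℕ∞) :=
    ι₀.isEmbedding.isInducing.topologicalKrullDim_le.trans hdimW
  have hcharP : CharHypothesis (Spec (s.W.presheaf.stalk s.pt)) o := by
    obtain ⟨d, hd, hchar'⟩ := hchar
    have hle : topologicalKrullDim ↥(Spec (s.W.presheaf.stalk s.pt)) ≤ (d : WithBot ℕ∞) :=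
      hd ▸ ι₀.isEmbedding.isInducing.topologicalKrullDim_le
    have h0 : 0 ≤ topologicalKrullDim ↥(Spec (s.W.presheaf.stalk s.pt)) := by
      haveI : Nonempty (IrreducibleCloseds ↥(Spec (s.W.presheaf.stalk s.pt))) :=
        ⟨⟨closure {o}, isIrreducible_singleton.closure, isClosed_closure⟩⟩
      exact Order.krullDim_nonneg
    obtain ⟨d', hd', hd'd⟩ : ∃ d' : ℕ, topologicalKrullDim ↥(Spec (s.W.presheaf.stalk s.pt)) = (d' : WithBot ℕ∞) ∧ d' ≤ d := by
      generalize hv : topologicalKrullDim ↥(Spec (s.W.presheaf.stalk s.pt)) = v at hle h0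
      induction v using WithBot.recBotCoe with
      | bot => exact absurd h0 (by simp)
      | coe w =>
        induction w using ENat.recTopCoe with
        | top => exact absurd (top_le_iff.mp (WithBot.coe_le_coe.mp hle)) (ENat.coe_ne_top d)
        | coe m =>
          refine ⟨m, rfl, ?_⟩
          have : ((m : ℕ∞) : WithBot ℕ∞) ≤ ((d : ℕ∞) : WithBot ℕ∞) := hle
          exact_mod_cast this
    have hκ : ringChar (ResidueField ((Spec (s.W.presheaf.stalk s.pt)).presheaf.stalk o)) =
        ringChar (ResidueField (s.W.presheaf.stalk s.pt)) := by
      rw [Helpers.ringChar_residueField_eq_of_hom' ι₀ o, hι₀o]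
    refine ⟨d', hd', ?_⟩
    rw [hκ]
    rcases hchar' with h0' | h2
    · exact Or.inl h0'
    · exact Or.inr (by omega)
  have hνP : Scheme.hsFun (Spec (s.W.presheaf.stalk s.pt)) N o = ν := by
    rw [Scheme.hsFun_eq_of_isIso_stalkMap ι₀ N o, hι₀o]
    exact Scheme.mem_hsStratum_iff.mp hptn
  have heP : Scheme.dirDim (Spec (s.W.presheaf.stalk s.pt)) o = 2 := by
    rw [Scheme.dirDim_eq_of_isIso_stalkMap ι₀ o, hι₀o]
    exact he
  -- the stratum of `P` is the preimage of the stratum of `Bl`, hence closed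
  have hstrP : Scheme.hsStratum P N ν = j.base ⁻¹' Scheme.hsStratum (blowup C₂) N ν := by
    ext z
    haveI := isIso_stalkMap_of_flat_of_isPreimmersion j z
    rw [Scheme.mem_hsStratum_iff, Set.mem_preimage, Scheme.mem_hsStratum_iff, Scheme.hsFun_eq_of_isIso_stalkMap j N z]
  have hWc : IsClosed (Scheme.hsStratum sP.W N ν) := by
    change IsClosed (Scheme.hsStratum P N ν)
    rw [hstrP]; exact hY'cl'.preimage j.continuous
  -- res-D-pv-038's theorem on the localised step
  obtain ⟨huniq, hregP⟩ := strataCentreMembersClean_pointCase (N := N) (ν := ν) hPa h314pt sP πP hoc hexc hperm hbl hdim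
    hcharP hνP heP hWc
  -- members over `x_n` correspond to members of `P` through `q` over `o`
  have hrange : (blowup.π C₂).base ⁻¹' {s.pt} ⊆ Set.range j.base := by
    intro z hz
    rw [hj, Scheme.Pullback.range_fst]
    exact ⟨o, hι₀o.trans (Set.mem_singleton_iff.mp hz).symm⟩
  have hmem : ∀ Z' ∈ componentsThrough N ν
      (⟨blowup C₂, hln, s.L.next (Scheme.hsStratum s.W N ν) C₂, P₂, x'⟩ : MarkedStage.{u}),
      (blowup.π C₂).base '' Z' ⊆ {s.pt} →
      j.base ⁻¹' Z' ∈ componentsThrough N ν sP ∧ πP.base '' (j.base ⁻¹' Z') ⊆ {o} ∧ Z' ⊆ Set.range j.base := by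
    intro Z' hZ' hZ'x
    have hZ'r : Z' ⊆ Set.range j.base := fun z hz => hrange (hZ'x ⟨z, hz, rfl⟩)
    have hZ'irr : IsIrreducible Z' := componentsIn.isIrreducible hZ'.1
    refine ⟨⟨?_, ?_⟩, ?_, hZ'r⟩
    · -- a component of the stratum of `P`
      refine mem_componentsIn_iff.mpr ⟨?_, isIrreducible_preimage_of_isEmbedding j.isEmbedding hZ'irr hZ'r, ?_⟩
      · change j.base ⁻¹' Z' ⊆ Scheme.hsStratum P N ν
        rw [hstrP]; exact Set.preimage_mono (componentsIn.subset hZ'.1)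
      · intro T hT hTirr hsub
        -- `closure j(T)` is irreducible, inside the (closed) stratum, and contains `Z′`
        have h1 : Z' ⊆ closure (j.base '' T) := by
          intro z hz
          obtain ⟨t, rfl⟩ := hZ'r hz
          exact subset_closure ⟨t, hsub hz, rfl⟩
        have h2 : closure (j.base '' T) ⊆ Scheme.hsStratum (blowup C₂) N ν := by
          refine closure_minimal ?_ hY'cl'
          rintro _ ⟨t, ht, rfl⟩
          have := hT ht
          change t ∈ Scheme.hsStratum P N ν at this
          rw [hstrP] at this
          exact this
        have h3 : closure (j.base '' T) = Z' :=
          ((mem_componentsIn_iff.mp hZ'.1).2.2 _ h2 ((hTirr.image _ j.continuous.continuousOn).closure) h1).antisymm h1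
        intro t ht
        show j.base t ∈ Z'
        rw [← h3]; exact subset_closure ⟨t, ht, rfl⟩
    · show q ∈ j.base ⁻¹' Z'
      rw [Set.mem_preimage, hjq]; exact hZ'.2
    · rintro _ ⟨t, ht, rfl⟩
      have h1 : ι₀.base (πP.base t) = s.pt := by
        have := congrArg (fun φ => φ.base t) hsq
        change ((j ≫ blowup.π C₂).base t) = ((πP ≫ ι₀).base t) at this
        rw [Scheme.Hom.comp_apply, Scheme.Hom.comp_apply] at this
        rw [← this]; exact hZ'x ⟨_, ht, rfl⟩
      exact ι₀.isEmbedding.injective (h1.trans hι₀o.symm)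
  refine ⟨fun Z' hZ' Z'' hZ'' h' h'' => ?_, fun Z' hZ' h' => ?_⟩
  · obtain ⟨hm', ho', hr'⟩ := hmem Z' hZ' h'
    obtain ⟨hm'', ho'', hr''⟩ := hmem Z'' hZ'' h''
    have heq := huniq _ hm' _ hm'' ho' ho''
    rw [← Set.image_preimage_eq_of_subset hr', ← Set.image_preimage_eq_of_subset hr'']
    exact congrArg _ heq
  · obtain ⟨hm', ho', -⟩ := hmem Z' hZ' h'
    have hregZ := hregP _ hm' ho'
    exact isRegularCurveAt_of_preimage (s := ⟨blowup C₂, hln, s.L.next (Scheme.hsStratum s.W N ν) C₂, P₂, x'⟩)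
      (s' := sP) j hjq hcl (componentsIn.isIrreducible hZ'.1) (componentsIn.isClosed hY'cl' hZ'.1) hregZ

/-- **ROW (K-ctr-pt) CLOSED modulo print**: `StrataPointCentreMembersClean p 3 (QNe (QCharRegime p)) (ē ≤ 2)` from
`ProjDir_projLine` and `Thm314_point_locus`. [cite: CossartJannsenSaito2020, Thm. 3.14, Def. 6.38 (ii), Prop. 6.31] -/
theorem strataPointCentreMembersClean_of_pointCase {p : ℕ} (hPa : ProjDir_projLine.{u}) (h314pt : Thm314_point_locus.{u}) :
    StrataPointCentreMembersClean.{u} p 3 (QNe (Helpers.QCharRegime p)) fun s => s.geomDirDim ≤ 2 := by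
  intro R hRf hRa ν X _ x hX hQ c h0 hstep _ _ _
  obtain ⟨hq, hν⟩ := hQ
  obtain ⟨k, _, _, g, -, hft, hqc⟩ := hX.exists_structure
  haveI := hft
  haveI := hqc
  haveI := hX.isReduced
  obtain ⟨-, k', _, hinv⟩ := exists_cycleInv_chain' hRf hRa hX h0 hstep
  refine ⟨0, fun n _ C P' hcs hxC hgerm he f hf => ?_⟩
  have hgood : StateGood k R 3 ν (c n).W (c n).L (c n).P :=
    stateGood_of_reaches (stateGood_init_general hRa g hX.dim_le hX.maximal hν) (reaches_chain h0 hstep n)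
  have hchar : CharHypothesis (c n).W (c n).pt := charHypothesis_of_qCharRegime hX hq (reaches_chain h0 hstep n) hgood
  have hptn : (c n).pt ∈ Scheme.hsStratum (c n).W 3 ν := pt_mem_hsStratum_of_reaches hX.mem_stratum (reaches_chain h0 hstep n)
  obtain ⟨hCreg, -, hCperm, -⟩ := (hinv n).centre hRa hν hcs
  haveI : IsLocallyNoetherian (c n).W := (c n).ln
  haveI : IsNoetherian (c n).W := (hinv n).isNoetherian
  exact hf.pointGerm_members_clean hPa h314pt hRf hcs (hinv (n + 1)).isNoetherian hgood.isExcellent hgood.dim_le hchar hptn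
    (hinv (n + 1)).isClosed_hsStratum hCreg hCperm hxC hgerm he

/-! ## §3. The strata-half from four printed facts and two local kernels -/

/-- **(K-ctr) from print + (K-ctr-cv).** [cite: CossartJannsenSaito2020, Thm. 3.14, Def. 6.38 (ii)] -/
theorem strataCentreMembersClean_of_pointCase_curve {p : ℕ} (h314 : CossartJannsenSaito2020_thm_3_14.{u})
    (h314f : Thm314_nearFibre_subsingleton.{u}) (hPa : ProjDir_projLine.{u}) (h314pt : Thm314_point_locus.{u})
    (hcv : StrataCurveCentreDominantClean.{u} p 3 (QNe (Helpers.QCharRegime p)) fun s => s.geomDirDim ≤ 2) :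
    StrataCentreMembersClean.{u} p 3 (QNe (Helpers.QCharRegime p)) fun s => s.geomDirDim ≤ 2 :=
  strataCentreMembersClean_of_point_curve h314 h314f (strataPointCentreMembersClean_of_pointCase hPa h314pt) hcv

/-- **`Wlow3CharStrataM p` FROM FOUR PRINTED FACTS (CJS Thm. 3.14 ×3 renderings, Def. 6.38 (ii)) AND THE TWO LOCAL KERNELS (K-ctr-cv),
(c-geo).** [cite: CossartJannsenSaito2020, Thm. 3.14, Def. 6.38 (ii), Thm. 6.35, Rem. 6.29 (1)] -/
theorem wlow3CharStrataM_of_printed_curve_centreIO {p : ℕ} (h314 : CossartJannsenSaito2020_thm_3_14.{0})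
    (h314f : Thm314_nearFibre_subsingleton.{0}) (hPa : ProjDir_projLine.{0}) (h314pt : Thm314_point_locus.{0})
    (hcv : StrataCurveCentreDominantClean.{0} p 3 (QNe (Helpers.QCharRegime p)) fun s => s.geomDirDim ≤ 2)
    (hgeo : StrataLineageInCentreIO.{0} p 3 (QNe (Helpers.QCharRegime p)) fun s => s.geomDirDim ≤ 2) :
    Wlow3CharStrataM p :=
  wlow3CharStrataM_of_thm_3_14_point_curve_centreIO h314 h314f (strataPointCentreMembersClean_of_pointCase hPa h314pt) hcv hgeo

end Summit.ResolutionOfSingularities.ResolutionOfSingularities.Theorems.SigmaMaxModificationsCorridor3.Moving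

end
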